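import Mathlib
import Summits.CriticalPhenomena.SAWScalingLimit.Theorems.ObservableToSLE.Negative.TightnessNecessity
import Literature.Probability.RandomPlanarGeometry.SimpleCurves
import Literature.Probability.RandomPlanarGeometry.CritPercSLESimplePathHolds
import Literature.Probability.RandomPlanarGeometry.ConformalRestrictionProofs
import Literature.Probability.LatticeModels.PolylinePrefix

/-!
# The uniform injectivity modulus is NECESSARY for the conclusion of crux `ObservableToSLE`
# (stmt-CriticalPhenomena-10472)

Negative/structural lemmas (refuter, cdisprove gen 6, obstruction W6).  The line
`floor-ratio-restriction-bootstrap` has landed its simplicity stub `stub_chordalCarrier` MODULO one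
isolated lattice estimate, the **uniform injectivity modulus** (UIM) of the critical hexagonal SAW
(`FloorRatio.stub_chordalCarrier_ofModulus`, first hypothesis): for every `ε, η > 0` there is
`θ > 0` such that for all small meshes, with probability `≥ 1 - η`, the rescaled walk has the
injectivity modulus `(ε, θ)` (`CurveClass.modulusClass ε θ`).  We prove that UIM is a CONSEQUENCE
of the crux's conclusion (DCS Conjecture 1 as typed, item `HexConjecture`), for every Dobrushin
domain and every endpoint approximation — so, like tightness (W5, `TightnessNecessity`), it is not
refutable short of refuting Conjecture 1 itself, and conversely every proof of the crux proves it: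

* `mem_modulusSet_of_dist_lt`, `mem_modulusClass_of_dist_lt` — injectivity moduli are STABLE in the
  reparametrisation distance with a linear loss: a class `r`-close to a class of modulus `(ε, θ)` has
  modulus `(ε + 2r, θ - 2r)`;
* `const_mem_modulusClass` — the modulus events are never empty;
* `uniformModulus_of_convergesInLawToSLE` — convergence in law to chordal SLE_κ, `0 < κ ≤ 4`, of the
  critical hexagonal SAW curve classes forces UIM (Rohde–Schramm simplicity of the limit, the
  `F_σ` description of the simple classes by CLOSED modulus events, continuity from above, one
  Urysohn function `min 1 (infDist · (modulusClass (ε/2) (2θ)) / r)` which is `1` on the open bad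
  event `(modulusClass ε θ)ᶜ` by the stability lemma, and the portmanteau inequality along `𝓝[>] 0`);
* `uniformModulus_of_hexConjecture` — `HexConjecture →` UIM for all Dobrushin domains and endpoint
  approximations; `floorUniformModulus_of_hexConjecture` — verbatim the first hypothesis of
  `FloorRatio.stub_chordalCarrier_ofModulus`;
* `polyline_cons_apply_prefixTime`, `not_mem_modulusClass_of_vertexReturn`,
  `noRetrace_of_uniformModulus`, `noRetrace_of_convergesInLawToSLE`, `noRetrace_of_hexConjecture` —
  the VERTEX-level typing `NoRetrace` of the sibling line `coalescent-arc-restriction` (the hypothesis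
  of `FloorRatio.stub_chordalCarrier_noRetrace`: no vertices `v_i, v_j, v_k`, `i ≤ j ≤ k`, with
  `|v_i − v_k| ≤ r` and `|v_i − v_j| ≥ ε`) follows from UIM already at the LATTICE level (each mesh),
  because vertex `k` of the walk is the rescaled polyline at the dyadic time `1 − 2^{-k}`, monotone in
  `k`; with the line's converse the two typings are equivalent up to constants, and both follow from
  `HexConjecture`.
-/

noncomputable section

open Literature.Probability.RandomPlanarGeometry Literature.Probability.RandomPlanarGeometry.SAW
  Literature.Probability.LatticeModels Literature.Probability MeasureTheory Filter Topology Set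
open scoped NNReal ENNReal BoundedContinuousFunction unitInterval

namespace Summit.CriticalPhenomena.SAWScalingLimit.Theorems.ObservableToSLE.Negative

/-! ### Stability of injectivity moduli in the reparametrisation distance -/

/-- **Stability of injectivity moduli (curves).**  If `γ'` has injectivity modulus `(ε, θ)` and
`dist γ γ' < r` in the reparametrisation pseudo-distance, then `γ` has modulus `(ε + 2r, θ - 2r)`:
reparametrise `γ'` to sup distance `< r` (Aizenman–Burchard) and use two triangle inequalities.
[folklore] -/
theorem mem_modulusSet_of_dist_lt {E : Type*} [PseudoMetricSpace E] {ε θ r : ℝ} {γ γ' : Curve E}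
    (hγ' : γ' ∈ (Curve.modulusSet ε θ : Set (Curve E))) (hd : dist γ γ' < r) :
    γ ∈ (Curve.modulusSet (ε + 2 * r) (θ - 2 * r) : Set (Curve E)) := by
  intro s u t hsu hut hst
  obtain ⟨φ, hφ⟩ := Curve.exists_dist_reparam_lt hd
  have hmem := Curve.reparam_mem_modulusSet hγ' φ
  set γ'' := γ'.reparam φ
  have hpt : ∀ x, dist (γ x) (γ'' x) < r := fun x ↦
    (ContinuousMap.dist_apply_le_dist (f := γ.toContinuousMap) (g := γ''.toContinuousMap) x).trans_lt
      hφ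
  have h1 : dist (γ'' s) (γ'' t) < θ := by
    have h4 := dist_triangle4 (γ'' s) (γ s) (γ t) (γ'' t)
    have hs := hpt s
    have ht := hpt t
    rw [dist_comm] at hs
    linarith
  have h2 := hmem s u t hsu hut h1
  have h4 := dist_triangle4 (γ s) (γ'' s) (γ'' u) (γ u)
  have hs := hpt s
  have hu := hpt u
  rw [dist_comm] at hu
  linarith

/-- **Stability of injectivity moduli (classes).**  A class at distance `< r` from a class in
`modulusClass ε θ` lies in `modulusClass (ε + 2r) (θ - 2r)`. [folklore] -/
theorem mem_modulusClass_of_dist_lt {E : Type*} [MetricSpace E] {ε θ r : ℝ} {c c' : CurveClass E}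
    (hc' : c' ∈ CurveClass.modulusClass ε θ) (hd : dist c c' < r) :
    c ∈ CurveClass.modulusClass (ε + 2 * r) (θ - 2 * r) := by
  obtain ⟨γ, rfl⟩ := CurveClass.surjective_mk c
  obtain ⟨γ', rfl⟩ := CurveClass.surjective_mk c'
  rw [CurveClass.dist_mk_mk] at hd
  exact ⟨γ, rfl, mem_modulusSet_of_dist_lt (CurveClass.mem_modulusSet_of_mk_mem hc') hd⟩

/-- Constant classes have every injectivity modulus with `ε ≥ 0`; in particular the modulus
events are nonempty. [folklore] -/
theorem const_mem_modulusClass {E : Type*} [MetricSpace E] (x : E) {ε : ℝ} (hε : 0 ≤ ε) (θ : ℝ) :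
    CurveClass.mk (Curve.const x) ∈ CurveClass.modulusClass ε θ := by
  refine ⟨Curve.const x, rfl, fun s u t _ _ _ ↦ ?_⟩
  rw [Curve.const_apply, Curve.const_apply, dist_self]
  exact hε

/-- Outside the `r`-neighbourhood of `modulusClass ε' θ'` (`ε' ≥ 0`) lies every class WITHOUT
modulus `(ε' + 2r, θ' - 2r)`: its distance to the smaller modulus event is `≥ r`. [folklore] -/
theorem le_infDist_modulusClass {ε' θ' r : ℝ} (hε' : 0 ≤ ε') {c : CurveClass ℂ}
    (hc : c ∉ CurveClass.modulusClass (ε' + 2 * r) (θ' - 2 * r)) :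
    r ≤ Metric.infDist c (CurveClass.modulusClass ε' θ') := by
  by_contra h
  rw [not_le] at h
  have hne : (CurveClass.modulusClass ε' θ' : Set (CurveClass ℂ)).Nonempty :=
    ⟨_, const_mem_modulusClass (0 : ℂ) hε' θ'⟩
  obtain ⟨c', hc', hd⟩ := (Metric.infDist_lt_iff hne).1 h
  exact hc (mem_modulusClass_of_dist_lt hc' hd)

/-! ### The uniform injectivity modulus follows from convergence to SLE_κ, `κ ≤ 4` -/

/-- **UIM IS NECESSARY.**  If the critical hexagonal SAW curve classes in `(D; a_δ, b_δ)` converge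
in law to chordal SLE_κ with `0 < κ ≤ 4`, then for every `ε, η > 0` there is `θ > 0` such that for
all small meshes the law charges the bad event "no injectivity modulus `(ε, θ)`" at most `η`.
Proof: the SLE_κ law is carried by the simple classes (Rohde–Schramm, `IsSLELaw.ae_simple`), which
lie in `⋃ₘ modulusClass (ε/2) (1/(m+1))` (`Curve.IsSimple.exists_mem_modulusSet`); by continuity
from above some `G = modulusClass (ε/2) θ₀` has `μ Gᶜ < η`; with `r = min θ₀ ε / 4` and
`θ = θ₀ - 2r` the open bad event `(modulusClass ε θ)ᶜ ⊆ (modulusClass (ε/2 + 2r) (θ₀ - 2r))ᶜ`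
is at distance `≥ r` from the CLOSED set `G` (`le_infDist_modulusClass`), so the Urysohn function
`g = min 1 (infDist · G / r)` is `1` there and `0` on `G`; `∫ g dP_δ → ∫ g dμ ≤ μ Gᶜ < η`
along `𝓝[>] 0`, and `P_δ(bad) ≤ ∫ g dP_δ` on the (eventual) probability laws. [folklore] -/
theorem uniformModulus_of_convergesInLawToSLE {κ : ℝ≥0} (h0 : 0 < κ) (h4 : κ ≤ 4)
    {D : DobrushinDomain} {a b : ℝ → HexVertex}
    (h : ConvergesInLawToSLE κ D (fun δ (γ : HexDomainSAW D.carrier δ (a δ) (b δ)) => γ.curve)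
      (fun δ => hexSAWLaw D.carrier δ (a δ) (b δ)))
    {ε η : ℝ} (hε : 0 < ε) (hη : 0 < η) :
    ∃ θ : ℝ, 0 < θ ∧ ∀ᶠ δ : ℝ in 𝓝[>] 0,
      hexSAWLaw D.carrier δ (a δ) (b δ) {γ | γ.curve ∉ CurveClass.modulusClass ε θ} ≤
        ENNReal.ofReal η := by
  classical
  have hab : IsEmbEndpointApprox hexGraph hexCenter D a b :=
    isEmbEndpointApprox_of_convergesInLawToSLE h
  obtain ⟨Γ, hΓ, -, hT⟩ := h
  haveI := isProbabilityMeasure_preWienerMeasure'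
  set μ : Measure (CurveClass ℂ) := Process.preWienerMeasure.map Γ with hμ
  haveI hμP : IsProbabilityMeasure μ := Measure.isProbabilityMeasure_map hΓ.aemeasurable
  have hSLE : IsSLELaw κ D μ := ⟨Γ, hΓ, rfl⟩
  -- the limit law is carried by the simple classes
  have hsimple : ∀ᵐ c ∂μ, c ∈ CurveClass.simple :=
    (IsSLELaw.ae_simple ae_isSimpleTrace_sleTrace_of_le_four_holds
      CurveClass.measurableSet_simple_holds h0 h4 hSLE).mono fun c hc => hc.1
  -- the decreasing family of CLOSED-complement bad events at tolerance ε/2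
  set F : ℕ → Set (CurveClass ℂ) := fun m => (CurveClass.modulusClass (ε / 2) (1 / ((m : ℝ) + 1)))ᶜ
    with hF
  have hFmeas : ∀ m, MeasurableSet (F m) := fun m =>
    (CurveClass.isClosed_modulusClass _ _).measurableSet.compl
  have hFanti : Antitone F := by
    intro m n hmn
    refine Set.compl_subset_compl.2 (CurveClass.modulusClass_mono le_rfl ?_)
    have : (m : ℝ) + 1 ≤ (n : ℝ) + 1 := by exact_mod_cast Nat.succ_le_succ hmn
    exact one_div_le_one_div_of_le (by positivity) this
  have hFnull : μ (⋂ m, F m) = 0 := by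
    refine measure_mono_null ?_ (ae_iff.1 hsimple)
    intro c hc hcs
    -- a simple class has a modulus `(ε/2, 1/(m+1))` for some `m`
    obtain ⟨γ, hγ, rfl⟩ := hcs
    obtain ⟨θ₁, hθ₁, hmem⟩ := Curve.IsSimple.exists_mem_modulusSet hγ (ε := ε / 2) (half_pos hε)
    obtain ⟨m, hm⟩ := exists_nat_one_div_lt hθ₁
    have hcm : CurveClass.mk γ ∈ CurveClass.modulusClass (ε / 2) (1 / ((m : ℝ) + 1)) :=
      ⟨γ, rfl, Curve.modulusSet_mono le_rfl hm.le hmem⟩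
    exact (Set.mem_iInter.1 hc m) hcm
  have hFtend : Tendsto (fun m => μ (F m)) atTop (𝓝 0) := by
    have := tendsto_measure_iInter_atTop (μ := μ) (fun m => (hFmeas m).nullMeasurableSet) hFanti
      ⟨0, measure_ne_top μ _⟩
    rwa [hFnull] at this
  -- choose the level `m` with `μ (F m) < η / 2`
  have hη2 : (0 : ℝ≥0∞) < ENNReal.ofReal (η / 2) := ENNReal.ofReal_pos.2 (half_pos hη)
  obtain ⟨m, hm⟩ := (hFtend.eventually (gt_mem_nhds hη2)).exists
  set θ₀ : ℝ := 1 / ((m : ℝ) + 1) with hθ₀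
  have hθ₀pos : 0 < θ₀ := by positivity
  set r : ℝ := min θ₀ ε / 4 with hr
  have hrpos : 0 < r := by positivity
  have hrθ : 2 * r ≤ θ₀ / 2 := by
    have : min θ₀ ε ≤ θ₀ := min_le_left _ _
    rw [hr]; linarith
  have hrε : ε / 2 + 2 * r ≤ ε := by
    have : min θ₀ ε ≤ ε := min_le_right _ _
    rw [hr]; linarith
  set θ : ℝ := θ₀ - 2 * r with hθ
  have hθpos : 0 < θ := by rw [hθ]; linarith
  refine ⟨θ, hθpos, ?_⟩
  -- the closed good set `G` and a Urysohn function for it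
  set G : Set (CurveClass ℂ) := CurveClass.modulusClass (ε / 2) θ₀ with hG
  have hGclosed : IsClosed G := CurveClass.isClosed_modulusClass _ _
  have hμG : μ Gᶜ < ENNReal.ofReal (η / 2) := hm
  obtain ⟨g, hg0, hg1, hgG, hgfar⟩ := exists_urysohn_infDist G hrpos
  -- the bad event is far from `G`
  set U : Set (CurveClass ℂ) := (CurveClass.modulusClass ε θ)ᶜ with hU
  have hUmeas : MeasurableSet U := (CurveClass.isClosed_modulusClass _ _).measurableSet.compl
  have hgU : ∀ x ∈ U, g x = 1 := by
    intro x hx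
    refine hgfar x (le_infDist_modulusClass (half_pos hε).le fun hx' => hx ?_)
    exact CurveClass.modulusClass_mono hrε le_rfl hx'
  -- the limit integral is small
  have hlim : ∫ x, g x ∂μ < η := by
    refine (integral_urysohn_le hGclosed hg1 hgG).trans_lt ?_
    rw [measureReal_def]
    have h1 : (μ Gᶜ).toReal ≤ η / 2 := ENNReal.toReal_le_of_le_ofReal (by positivity) hμG.le
    linarith
  have ht := hT g
  have hint_eq : ∫ ω, g (Γ ω) ∂Process.preWienerMeasure = ∫ x, g x ∂μ :=
    (integral_map hΓ.aemeasurable g.continuous.aestronglyMeasurable).symm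
  rw [hint_eq] at ht
  have hev : ∀ᶠ δ in 𝓝[>] (0 : ℝ),
      ∫ γ, g ((fun γ : HexDomainSAW D.carrier δ (a δ) (b δ) => γ.curve) γ)
        ∂hexSAWLaw D.carrier δ (a δ) (b δ) < η :=
    ht.eventually (Iio_mem_nhds hlim)
  filter_upwards [hev, eventually_isProbabilityMeasure_hexSAWLaw hab] with δ hδ hP
  haveI := hP
  have h1 : (hexSAWLaw D.carrier δ (a δ) (b δ)).real
      ((fun γ : HexDomainSAW D.carrier δ (a δ) (b δ) => γ.curve) ⁻¹' U) ≤
      ∫ γ, g ((fun γ : HexDomainSAW D.carrier δ (a δ) (b δ) => γ.curve) γ)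
        ∂hexSAWLaw D.carrier δ (a δ) (b δ) :=
    measureReal_preimage_le_integral (EmbDomainSAW.measurable_of_top _) hUmeas hg0 hgU
  change hexSAWLaw D.carrier δ (a δ) (b δ)
      ((fun γ : HexDomainSAW D.carrier δ (a δ) (b δ) => γ.curve) ⁻¹' U) ≤ ENNReal.ofReal η
  rw [← ofReal_measureReal (measure_ne_top _ _)]
  exact ENNReal.ofReal_le_ofReal (h1.trans hδ.le)

/-- **`HexConjecture` implies the uniform injectivity modulus** of the critical hexagonal SAW, for
every Dobrushin domain and every endpoint approximation (`κ = 8/3 ≤ 4`). [folklore] -/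
theorem uniformModulus_of_hexConjecture
    (h : Summit.CriticalPhenomena.SAWScalingLimit.Theses.SAWDevelopingMap.HexConjecture)
    (D : DobrushinDomain) (a b : ℝ → HexVertex) (hab : IsEmbEndpointApprox hexGraph hexCenter D a b)
    {ε η : ℝ} (hε : 0 < ε) (hη : 0 < η) :
    ∃ θ : ℝ, 0 < θ ∧ ∀ᶠ δ : ℝ in 𝓝[>] 0,
      hexSAWLaw D.carrier δ (a δ) (b δ) {γ | γ.curve ∉ CurveClass.modulusClass ε θ} ≤
        ENNReal.ofReal η := by
  refine uniformModulus_of_convergesInLawToSLE (κ := (8 : ℝ≥0) / 3) (by positivity) ?_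
    (h D a b hab) hε hη
  rw [div_le_iff₀ (by norm_num : (0 : ℝ≥0) < 3)]
  norm_num

/-- **`HexConjecture` implies the isolated estimate of the landed stub-5 reduction, verbatim**: the
first hypothesis of `FloorRatio.stub_chordalCarrier_ofModulus` (UIM on floor domains with floor
endpoint approximations).  Hence that estimate is not refutable independently of DCS Conjecture 1,
and every proof of the crux's conclusion re-proves it. [folklore] -/
theorem floorUniformModulus_of_hexConjecture
    (h : Summit.CriticalPhenomena.SAWScalingLimit.Theses.SAWDevelopingMap.HexConjecture) :
    ∀ (D : DobrushinDomain) (ρ : ℝ) (a b : ℝ → HexVertex),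
      (0 < ρ ∧ (D.pt 1).im = (D.pt 0).im ∧ D.carrier ⊆ {z : ℂ | (D.pt 0).im < z.im} ∧
      D.carrier ∩ Metric.ball (D.pt 0) ρ = {z : ℂ | (D.pt 0).im < z.im} ∩ Metric.ball (D.pt 0) ρ ∧
      D.carrier ∩ Metric.ball (D.pt 1) ρ = {z : ℂ | (D.pt 1).im < z.im} ∩ Metric.ball (D.pt 1) ρ) →
      (IsEmbEndpointApprox hexGraph hexCenter D a b ∧ ∀ᶠ δ : ℝ in 𝓝[>] 0,
      (∃ u : HexVertex, hexGraph.Adj (a δ) u ∧ ((δ : ℂ) * hexCenter u).im ≤ (D.pt 0).im) ∧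
      (∃ u : HexVertex, hexGraph.Adj (b δ) u ∧ ((δ : ℂ) * hexCenter u).im ≤ (D.pt 1).im)) →
      ∀ ε η : ℝ, 0 < ε → 0 < η → ∃ θ : ℝ, 0 < θ ∧ ∀ᶠ δ : ℝ in 𝓝[>] 0,
        hexSAWLaw D.carrier δ (a δ) (b δ) {γ | γ.curve ∉ CurveClass.modulusClass ε θ} ≤
          ENNReal.ofReal η :=
  fun D _ a b _ hab _ _ hε hη => uniformModulus_of_hexConjecture h D a b hab.1 hε hη

/-! ### The vertex-level `NoRetrace` estimate follows as well -/

section NoRetrace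

open Literature.Probability.LatticeModels

/-- **Vertices sit at ordered dyadic times.**  The polyline through `a :: l` is at the vertex
`(a :: l)[k]` at time `1 − 2^{-k}` (`k ≤ l.length`); these times increase with `k`. [folklore] -/
theorem polyline_cons_apply_prefixTime (a : ℂ) (l : List ℂ) {k : ℕ} (hk : k ≤ l.length) :
    polyline (a :: l) ⟨1 - (1 / 2) ^ k, one_sub_half_pow_mem_unitInterval k⟩ =
      (a :: l)[k]'(by rw [List.length_cons]; omega) := by
  obtain ⟨m, r, hl, hm⟩ : ∃ m r : List ℂ, l = m ++ r ∧ m.length = k :=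
    ⟨l.take k, l.drop k, (List.take_append_drop k l).symm, by rw [List.length_take]; omega⟩
  subst hl
  subst hm
  rw [polyline_cons_append_apply_prefixTime]
  apply Option.some_injective
  rw [← List.getElem?_eq_getElem, ← List.getLast?_eq_some_getLast, List.getLast?_eq_getElem?,
    List.length_cons, Nat.add_sub_cancel, ← List.cons_append,
    List.getElem?_append_left (by rw [List.length_cons]; omega)]

/-- The dyadic vertex times are monotone. [folklore] -/
theorem prefixTime_mono {i j : ℕ} (hij : i ≤ j) :
    (⟨1 - (1 / 2) ^ i, one_sub_half_pow_mem_unitInterval i⟩ : I) ≤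
      ⟨1 - (1 / 2) ^ j, one_sub_half_pow_mem_unitInterval j⟩ := by
  change (1 : ℝ) - (1 / 2) ^ i ≤ 1 - (1 / 2) ^ j
  have : ((1 : ℝ) / 2) ^ j ≤ (1 / 2) ^ i := pow_le_pow_of_le_one (by norm_num) (by norm_num) hij
  linarith

/-- **The vertex near-return event lies in the bad modulus event** (fixed mesh, no limit): if a
SAW of `Ω_δ` has vertices `v_i, v_j, v_k`, `i ≤ j ≤ k`, with `|δv_i − δv_k| ≤ r < θ` and
`|δv_i − δv_j| ≥ ε > ε'`, then its curve class has no injectivity modulus `(ε', θ)`: the three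
vertices are the rescaled polyline at the ordered dyadic times `1 − 2^{-i} ≤ 1 − 2^{-j} ≤ 1 − 2^{-k}`
(`polyline_cons_apply_prefixTime`). [folklore] -/
theorem not_mem_modulusClass_of_vertexReturn {Ω : Set ℂ} {δ : ℝ} {u v : HexVertex}
    (γ : HexDomainSAW Ω δ u v) {ε ε' θ r : ℝ} (hε : ε' < ε) (hr : r < θ) {i j k : ℕ}
    (hij : i ≤ j) (hjk : j ≤ k) (hk : k ≤ γ.walk.length)
    (hik : dist ((δ : ℂ) * hexCenter (γ.walk.getVert i)) ((δ : ℂ) * hexCenter (γ.walk.getVert k)) ≤ r)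
    (hεij : ε ≤ dist ((δ : ℂ) * hexCenter (γ.walk.getVert i))
      ((δ : ℂ) * hexCenter (γ.walk.getVert j))) :
    γ.curve ∉ CurveClass.modulusClass ε' θ := by
  intro hmod
  -- the canonical representative has modulus `(ε', θ)`
  have hrep : (⟨polyline (γ.walk.support.map fun w => (δ : ℂ) * hexCenter w)⟩ : Curve ℂ) ∈
      Curve.modulusSet ε' θ := CurveClass.mem_modulusSet_of_mk_mem hmod
  -- vertex times and values
  set f : HexVertex → ℂ := fun w => (δ : ℂ) * hexCenter w with hf
  have hsupp : γ.walk.support = u :: γ.walk.support.tail := (γ.walk.cons_tail_support).symm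
  have hlen : γ.walk.support.tail.length = γ.walk.length := by
    have := γ.walk.length_support
    rw [hsupp, List.length_cons] at this
    omega
  have hval : ∀ n : ℕ, n ≤ γ.walk.length →
      polyline (γ.walk.support.map f) ⟨1 - (1 / 2) ^ n, one_sub_half_pow_mem_unitInterval n⟩ =
        f (γ.walk.getVert n) := by
    intro n hn
    have hn' : n ≤ (γ.walk.support.tail.map f).length := by rwa [List.length_map, hlen]
    rw [hsupp, List.map_cons, polyline_cons_apply_prefixTime _ _ hn',
      γ.walk.getVert_eq_support_getElem hn]
    simp only [← List.map_cons, ← hsupp, List.getElem_map]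
  have hi : i ≤ γ.walk.length := hij.trans (hjk.trans hk)
  have hj : j ≤ γ.walk.length := hjk.trans hk
  have key := hrep ⟨1 - (1 / 2) ^ i, one_sub_half_pow_mem_unitInterval i⟩
    ⟨1 - (1 / 2) ^ j, one_sub_half_pow_mem_unitInterval j⟩
    ⟨1 - (1 / 2) ^ k, one_sub_half_pow_mem_unitInterval k⟩ (prefixTime_mono hij)
    (prefixTime_mono hjk)
  change dist (polyline (γ.walk.support.map f) _) (polyline (γ.walk.support.map f) _) < θ →
    dist (polyline (γ.walk.support.map f) _) (polyline (γ.walk.support.map f) _) ≤ ε' at key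
  rw [hval i hi, hval j hj, hval k hk] at key
  have := key (by linarith)
  linarith

/-- **UIM implies `NoRetrace` at the lattice level** (each mesh, no scaling limit): the uniform
injectivity modulus gives the vertex-level no-retrace estimate with `r = θ/2` (where `θ` is the
modulus for tolerance `ε/2`).  With the line's converse `FloorRatio.uniformModulus_of_noRetrace` the
two typings of the range → curve input are EQUIVALENT up to constants. [folklore] -/
theorem noRetrace_of_uniformModulus {D : DobrushinDomain} {a b : ℝ → HexVertex}
    (hU : ∀ ε η : ℝ, 0 < ε → 0 < η → ∃ θ : ℝ, 0 < θ ∧ ∀ᶠ δ : ℝ in 𝓝[>] 0,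
      hexSAWLaw D.carrier δ (a δ) (b δ) {γ | γ.curve ∉ CurveClass.modulusClass ε θ} ≤
        ENNReal.ofReal η)
    {ε η : ℝ} (hε : 0 < ε) (hη : 0 < η) :
    ∃ r : ℝ, 0 < r ∧ ∀ᶠ δ : ℝ in 𝓝[>] 0,
      hexSAWLaw D.carrier δ (a δ) (b δ)
          {γ | ∃ i j k : ℕ, i ≤ j ∧ j ≤ k ∧ k ≤ γ.walk.length ∧
              dist ((δ : ℂ) * hexCenter (γ.walk.getVert i))
                ((δ : ℂ) * hexCenter (γ.walk.getVert k)) ≤ r ∧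
              ε ≤ dist ((δ : ℂ) * hexCenter (γ.walk.getVert i))
                ((δ : ℂ) * hexCenter (γ.walk.getVert j))}
        ≤ ENNReal.ofReal η := by
  obtain ⟨θ, hθ, hev⟩ := hU (ε / 2) η (half_pos hε) hη
  refine ⟨θ / 2, half_pos hθ, ?_⟩
  filter_upwards [hev] with δ hδ
  refine (measure_mono fun γ hγ ↦ ?_).trans hδ
  obtain ⟨i, j, k, hij, hjk, hk, hik, hεij⟩ := hγ
  exact not_mem_modulusClass_of_vertexReturn γ (half_lt_self hε) (half_lt_self hθ) hij hjk hk hik hεij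

/-- **`NoRetrace` IS NECESSARY.**  Convergence in law to chordal SLE_κ, `0 < κ ≤ 4`, of the critical
hexagonal SAW curve classes forces the vertex-level no-retrace estimate: for every `ε, η > 0` there
is `r > 0` such that for all small meshes, with probability `≤ η` the walk has vertices
`v_i, v_j, v_k`, `i ≤ j ≤ k`, with `|δv_i − δv_k| ≤ r` and `|δv_i − δv_j| ≥ ε`. [folklore] -/
theorem noRetrace_of_convergesInLawToSLE {κ : ℝ≥0} (h0 : 0 < κ) (h4 : κ ≤ 4)
    {D : DobrushinDomain} {a b : ℝ → HexVertex}
    (h : ConvergesInLawToSLE κ D (fun δ (γ : HexDomainSAW D.carrier δ (a δ) (b δ)) => γ.curve)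
      (fun δ => hexSAWLaw D.carrier δ (a δ) (b δ)))
    {ε η : ℝ} (hε : 0 < ε) (hη : 0 < η) :
    ∃ r : ℝ, 0 < r ∧ ∀ᶠ δ : ℝ in 𝓝[>] 0,
      hexSAWLaw D.carrier δ (a δ) (b δ)
          {γ | ∃ i j k : ℕ, i ≤ j ∧ j ≤ k ∧ k ≤ γ.walk.length ∧
              dist ((δ : ℂ) * hexCenter (γ.walk.getVert i))
                ((δ : ℂ) * hexCenter (γ.walk.getVert k)) ≤ r ∧
              ε ≤ dist ((δ : ℂ) * hexCenter (γ.walk.getVert i))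
                ((δ : ℂ) * hexCenter (γ.walk.getVert j))}
        ≤ ENNReal.ofReal η :=
  noRetrace_of_uniformModulus
    (fun _ _ hε' hη' => uniformModulus_of_convergesInLawToSLE h0 h4 h hε' hη') hε hη

/-- **`HexConjecture` implies `NoRetrace`** (the hypothesis of `FloorRatio.stub_chordalCarrier_noRetrace`,
verbatim), for every Dobrushin domain and endpoint approximation. [folklore] -/
theorem noRetrace_of_hexConjecture
    (h : Summit.CriticalPhenomena.SAWScalingLimit.Theses.SAWDevelopingMap.HexConjecture)
    (D : DobrushinDomain) (a b : ℝ → HexVertex) (hab : IsEmbEndpointApprox hexGraph hexCenter D a b) :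
    ∀ ε η : ℝ, 0 < ε → 0 < η → ∃ r : ℝ, 0 < r ∧ ∀ᶠ δ : ℝ in 𝓝[>] 0,
      hexSAWLaw D.carrier δ (a δ) (b δ)
          {γ | ∃ i j k : ℕ, i ≤ j ∧ j ≤ k ∧ k ≤ γ.walk.length ∧
              dist ((δ : ℂ) * hexCenter (γ.walk.getVert i))
                ((δ : ℂ) * hexCenter (γ.walk.getVert k)) ≤ r ∧
              ε ≤ dist ((δ : ℂ) * hexCenter (γ.walk.getVert i))
                ((δ : ℂ) * hexCenter (γ.walk.getVert j))}
        ≤ ENNReal.ofReal η := by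
  intro ε η hε hη
  refine noRetrace_of_convergesInLawToSLE (κ := (8 : ℝ≥0) / 3) (by positivity) ?_ (h D a b hab) hε hη
  rw [div_le_iff₀ (by norm_num : (0 : ℝ≥0) < 3)]
  norm_num

end NoRetrace

end Summit.CriticalPhenomena.SAWScalingLimit.Theorems.ObservableToSLE.Negative
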